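import Literature.NumberTheory.EllipticCurves.SexticTwistHeckeCoefficients
import HarnessLib

/-!
# `a_n(E^k) = (u/n) · Σ_{N𝔞 = n} ν_u(𝔞) ϖ_𝔞` for `k = 16u`, `u ≡ 1 (4)` — the class of `y² = x³ + k` with good reduction at `2`

Topic `Literature/NumberTheory/EllipticCurves`, namespace `Literature.NumberTheory.EllipticCurves.SexticTwist` (sequel to
`SexticTwistHeckeCoefficients`, which treats every other sixth-power-free `k`).  Theorems only (no definition, no named fact).

For `k = 16u` with `u ≡ 1 (mod 4)` (so `u` odd, `k` sixth-power-free iff `u` is), the Mordell curve `E^k : y² = x³ + k` has GOOD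
(supersingular) reduction at `2` (minimal model `y² + y = x³ + (u − 1)/4`, the tree's `hasGoodReductionAt_mordell_four_of_emod_four_eq_one`;
`a_2 = 0`, `a_{4^m} = (−2)^m`, `SexticTwistLSeriesCoefficients`), so Ireland–Rosen's character «`χ(P) = 0` for `P ∣ 6D`» has to be corrected
at the inert prime `(2)` of `ℤ[ω]`: `χ((2)) = −2`.  Since `4k = 64u` is `u` times a cube and `k` is `u` times a square, the character is
`𝔭 ↦ (u/N𝔭)·(u/𝔭)₃·ϖ_𝔭` with support `(𝔭, 3u) = 1` — the parameter `4k` of the generic case replaced by `u` — and indeed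
`ν_u((2)) e(ϖ_{(2)}) = (u/(2))₃ · (−2) = −2` (`u ≡ 1 (mod 2)` is a cube modulo `(2)`):

  ★ `lFunction_eq_jacobiSym_mul_sum_of_eq_sixteen_mul` — **`a_n(E^{16u}) = (u/n) · Σ_{N𝔞 = n} ν_u(𝔞) e(ϖ_𝔞)`**, `ν_u = grossenNu u 1 0`,

for every `n`.  Proof as in the generic case: both sides multiplicative; at `p = 3` and `p ∣ u` both vanish; at `p = 2`:
`a_{4^m} = (−2)^m = (u/4^m)·ν_u((2))^m e(ϖ_{(2)})^m` (`weight_span_two`); at odd inert `p`: `(−p)^m`; at split `p`: Theorem 18.4 with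
`(k/p) = (u/p)` (`16 = 4²`) and `(4k/𝔭)₃ = (64u/𝔭)₃ = (u/𝔭)₃` (`64 = 4³`).

## References
* K. Ireland, M. Rosen, *A Classical Introduction to Modern Number Theory*, 2nd ed., GTM 84 (1990), Ch. 18 §7 with §6 Theorem 7 and
  §3 Theorem 4 (PDF pp. 298–306). [IrelandRosen1990]
* J. H. Silverman, *The Arithmetic of Elliptic Curves*, 2nd ed. (2009), VII.5 Prop. 5.1(a), §C.16. [SilvermanAEC2009]

## Mathlib / tree search
Tree: `SexticTwist.{lFunction_apply_prime_pow_eq_zero, lFunction_apply_prime_pow_of_mod_three_eq_two, lFunction_apply_two_pow_of_eq_sixteen_mul,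
lFunction_apply_prime_pow_split, twistCount_prime_pow_eq_zero_of_dvd, twistCount_prime_pow_of_mod_three_eq_two, twistCount_prime_pow_split,
weight_span_natCast_of_mod_three_eq_two}` (this cluster); `EisensteinGrossen.{grossenNu_apply, psi_asIdeal_eq, primeOf, primGen_span_natCast_of_mod_three_eq_two,
exists_split_data, grossenNu_conjPrime, primGen_eq_of, primGen_map_tau, embC_tau, intCast_not_mem}`, `K3.prime_natCast_of_mod_three_eq_two`;
`cubicResidueSymbol_one/_mul/_spec`.  Mathlib: `ArithmeticFunction.IsMultiplicative.eq_iff_eq_on_prime_powers`, `jacobiSym.mul_right'/pow_right`,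
`legendreSym.mul/sq_one'/to_jacobiSym`, `Irreducible.coprime_iff_not_dvd` (PID), `Ideal.isCoprime_span_singleton_iff`.
-/

noncomputable section

open scoped Classical ComplexConjugate

open NumberField IsDedekindDomain Finset
open Literature.NumberTheory.NumberFields Literature.NumberTheory.NumberFields.K3
open Literature.NumberTheory.GaloisRepresentations
open Literature.NumberTheory.LFunctions Literature.NumberTheory.LFunctions.NumberField
open Literature.NumberTheory.LFunctions.EisensteinGrossen Literature.NumberTheory.LFunctions.PlaneLattice

namespace Literature.NumberTheory.EllipticCurves

namespace SexticTwist

variable {k : ℤ}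

/-- `a_ν(n)` as a sum over the subtype of ideals of norm `n` (local copy). [folklore] -/
private theorem twistCount_eq_sum_subtype' (ν : Ideal (𝓞 K3) →*₀ ℂ) (n : ℕ) [Fintype {I : Ideal (𝓞 K3) // Ideal.absNorm I = n}] :
    twistCount K3 ν n = ∑ I : {I : Ideal (𝓞 K3) // Ideal.absNorm I = n}, ν I.1 := by
  rw [twistCount]
  exact Finset.sum_subtype (idealsOfNorm K3 n) (fun _ ↦ mem_idealsOfNorm) _

/-- `a_ν(mn) = a_ν(m) a_ν(n)` for coprime `m, n` (local copy). [cite: HeckeMathZ1920, §6] -/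
private theorem twistCount_mul_of_coprime' (ν : Ideal (𝓞 K3) →*₀ ℂ) {m n : ℕ} (h : m.Coprime n) :
    twistCount K3 ν (m * n) = twistCount K3 ν m * twistCount K3 ν n := by
  rcases Nat.eq_zero_or_pos m with rfl | hm
  · have hn : n = 1 := by simpa using h
    subst hn
    simp [twistCount_one, twistCount_zero]
  rcases Nat.eq_zero_or_pos n with rfl | hn
  · have hm1 : m = 1 := by simpa using h
    subst hm1
    simp [twistCount_one, twistCount_zero]
  letI : Fintype {I : Ideal (𝓞 K3) // Ideal.absNorm I = m * n} :=
    Fintype.ofFinset (idealsOfNorm K3 (m * n)) (fun _ ↦ mem_idealsOfNorm)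
  letI : Fintype {I : Ideal (𝓞 K3) // Ideal.absNorm I = m} := Fintype.ofFinset (idealsOfNorm K3 m) (fun _ ↦ mem_idealsOfNorm)
  letI : Fintype {I : Ideal (𝓞 K3) // Ideal.absNorm I = n} := Fintype.ofFinset (idealsOfNorm K3 n) (fun _ ↦ mem_idealsOfNorm)
  rw [twistCount_eq_sum_subtype' ν (m * n), twistCount_eq_sum_subtype' ν m, twistCount_eq_sum_subtype' ν n, Finset.sum_mul_sum,
    ← Fintype.sum_prod_type']
  symm
  refine Fintype.sum_equiv (IdealNormCount.equivProdOfCoprime K3 hm hn h).symm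
    (fun AB ↦ ν AB.1.1 * ν AB.2.1) (fun I ↦ ν I.1) fun AB ↦ ?_
  rw [← map_mul]
  rfl

/-- `ψ`-with-support times the primary generator is multiplicative on ideals. [cite: HeckeMathZ1920, §6] -/
private theorem weight_mul' (D : 𝓞 K3) (I J : Ideal (𝓞 K3)) :
    grossenNu D 1 0 (I * J) * embC (primGen (I * J) : K3) =
      (grossenNu D 1 0 I * embC (primGen I : K3)) * (grossenNu D 1 0 J * embC (primGen J : K3)) := by
  by_cases hI : Adm D I
  · by_cases hJ : Adm D J
    · rw [map_mul, primGen_mul hI.coprime_three hJ.coprime_three]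
      push_cast
      rw [map_mul]; ring
    · have hIJ : ¬ Adm D (I * J) := fun h ↦ hJ ((adm_mul_iff D).mp h).2
      rw [grossenNu_apply, if_neg hIJ, grossenNu_apply D 1 0 J, if_neg hJ]; ring
  · have hIJ : ¬ Adm D (I * J) := fun h ↦ hI ((adm_mul_iff D).mp h).1
    rw [grossenNu_apply, if_neg hIJ, grossenNu_apply D 1 0 I, if_neg hI]; ring

/-- **The weight at the inert prime `(2)` for odd `u`: `ν_u((2)) e(ϖ_{(2)}) = −2`** (`(2)` is prime to `3u`, `u ≡ 1 (mod 2)` is a cube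
modulo `(2)` so `(u/(2))₃ = 1`, and `ϖ_{(2)} = −2`): the corrected value «`χ((2)) = −2`» at the good supersingular prime `2`.
[cite: IrelandRosen1990, Ch. 18 §7 («`χ(P) = −p` for `P = (p)`, `p ≡ 2 (3)`»)] -/
theorem weight_span_two {u : ℤ} (hu : ¬ (2 : ℤ) ∣ u) :
    grossenNu ((u : ℤ) : 𝓞 K3) 1 0 (Ideal.span {(((2 : ℕ) : ℤ) : 𝓞 K3)}) * embC (primGen (Ideal.span {(((2 : ℕ) : ℤ) : 𝓞 K3)}) : K3) =
      -2 := by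
  have hp2 : Prime (((2 : ℕ) : ℤ) : 𝓞 K3) := prime_natCast_of_mod_three_eq_two Nat.prime_two (by norm_num)
  set v : HeightOneSpectrum (𝓞 K3) := primeOf hp2 with hv
  have hvI : Ideal.span {(((2 : ℕ) : ℤ) : 𝓞 K3)} = v.asIdeal := rfl
  have hvmem : (((2 : ℕ) : ℤ) : 𝓞 K3) ∈ v.asIdeal := Ideal.mem_span_singleton_self _
  have huv : ((u : ℤ) : 𝓞 K3) ∉ v.asIdeal := intCast_not_mem Nat.prime_two hvmem (by exact_mod_cast hu)
  have h3v : (3 : 𝓞 K3) ∉ v.asIdeal := by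
    have := intCast_not_mem Nat.prime_two hvmem (n := 3) (by norm_num)
    rwa [Int.cast_ofNat] at this
  have hadm : Adm ((u : ℤ) : 𝓞 K3) v.asIdeal := by
    refine ⟨v.ne_bot, ?_⟩
    rw [← hvI, Ideal.isCoprime_span_singleton_iff, Prime.coprime_iff_not_dvd hp2]
    intro h
    have h' : (((2 : ℕ) : ℤ) : 𝓞 K3) ∣ mkInt (3 * u) 0 := by
      rw [mkInt_intCast]; push_cast at h ⊢; exact h
    rw [intCast_dvd_mkInt_iff] at h'
    omega
  have hprim : primGen v.asIdeal = -((2 : ℕ) : 𝓞 K3) := by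
    rw [← hvI]; exact primGen_span_natCast_of_mod_three_eq_two (by norm_num : 2 % 3 = 2)
  rw [hvI, grossenNu_apply, if_pos hadm, psi_asIdeal_eq _ v huv h3v, pow_one, sectorWeight, pow_zero, mul_one, hprim]
  -- `u ≡ 1 (mod 2)`, so `χ_{(2)}(u) = χ_{(2)}(1) = 1`
  have hu1 : Ideal.Quotient.mk v.asIdeal ((u : ℤ) : 𝓞 K3) = 1 := by
    rw [← map_one (Ideal.Quotient.mk v.asIdeal), Ideal.Quotient.eq, ← hvI, Ideal.mem_span_singleton]
    obtain ⟨t, ht⟩ : ∃ t : ℤ, u - 1 = 2 * t := ⟨(u - 1) / 2, by omega⟩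
    refine ⟨((t : ℤ) : 𝓞 K3), ?_⟩
    have e1 : ((u : ℤ) : 𝓞 K3) - 1 = ((u - 1 : ℤ) : 𝓞 K3) := by push_cast; ring
    rw [e1, ht]; push_cast; ring
  rw [hu1, cubicResidueSymbol_one EisensteinGrossen.hζ h3v]
  simp [map_ofNat]

/-- ★ **Ireland–Rosen Ch. 18 §7 for `k = 16u`, `u ≡ 1 (4)`: `a_n(E^k) = (u/n) · Σ_{N𝔞 = n} ν_u(𝔞) e(ϖ_𝔞)`** for every `n` (`k` sixth-power-free;
`E^k = mordellCurve k`; `ν_u = grossenNu u 1 0` the cubic symbol `𝔞 ↦ (u/𝔞)₃` with support `(𝔞, 3u) = 1`; `(u/n)` the Jacobi symbol).  The one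
class of `y² = x³ + k` with good reduction at `2`: the prime `(2)` of `ℤ[ω]` now carries `ν_u((2)) e(ϖ_{(2)}) = −2` (`a_{4^m} = (−2)^m`).
[cite: IrelandRosen1990, Ch. 18 §7 with §6 Theorem 7 and §3 Theorem 4 (PDF pp. 298–306)] [cite: SilvermanAEC2009, §C.16] -/
theorem lFunction_eq_jacobiSym_mul_sum_of_eq_sixteen_mul {u : ℤ} (hu4 : u % 4 = 1) (hku : k = 16 * u)
    (h6 : ∀ q : ℕ, q.Prime → ¬ (q : ℤ) ^ 6 ∣ k) (n : ℕ) :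
    ((mordellCurve (k : ℚ)).LFunction n : ℂ) =
      (jacobiSym u n : ℂ) * ∑ I ∈ idealsOfNorm K3 n, grossenNu ((u : ℤ) : 𝓞 K3) 1 0 I * embC (primGen I : K3) := by
  have hu2 : ¬ (2 : ℤ) ∣ u := by omega
  have hu0 : u ≠ 0 := by rintro rfl; omega
  have hk : k ≠ 0 := by rw [hku]; exact mul_ne_zero (by norm_num) hu0
  set D : 𝓞 K3 := ((u : ℤ) : 𝓞 K3) with hD
  let ν : Ideal (𝓞 K3) →*₀ ℂ :=
    { toFun := fun I ↦ grossenNu D 1 0 I * embC (primGen I : K3)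
      map_zero' := by show grossenNu D 1 0 0 * _ = 0; rw [map_zero, zero_mul]
      map_one' := by show grossenNu D 1 0 1 * embC (primGen 1 : K3) = 1; rw [map_one, Ideal.one_eq_top, primGen_top]; simp
      map_mul' := fun I J ↦ weight_mul' D I J }
  have hν : ∀ I, ν I = grossenNu D 1 0 I * embC (primGen I : K3) := fun I ↦ rfl
  have hνsupp : ∀ I, ¬ IsCoprime I (Ideal.span {3 * D}) → ν I = 0 := fun I hI ↦ by
    rw [hν, grossenNu_apply, if_neg (fun h ↦ hI h.2), zero_mul]
  set f : ArithmeticFunction ℂ := ((mordellCurve (k : ℚ)).LFunction : ArithmeticFunction ℂ) with hf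
  let g : ArithmeticFunction ℂ := ⟨fun n ↦ (jacobiSym u n : ℂ) * twistCount K3 ν n, by simp [twistCount_zero]⟩
  have hg : ∀ n, g n = (jacobiSym u n : ℂ) * twistCount K3 ν n := fun n ↦ rfl
  have hfn : ∀ n, f n = ((mordellCurve (k : ℚ)).LFunction n : ℂ) := fun n ↦ ArithmeticFunction.intCoe_apply
  have hfmul : f.IsMultiplicative := (mordellCurve (k : ℚ)).isMultiplicative_LFunction.intCast
  have hgmul : g.IsMultiplicative := by
    refine ArithmeticFunction.IsMultiplicative.iff_ne_zero.mpr ⟨?_, ?_⟩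
    · rw [hg, jacobiSym.one_right, twistCount_one]; simp
    · intro m n hm hn hmn
      rw [hg, hg, hg, jacobiSym.mul_right' u hm hn, twistCount_mul_of_coprime' ν hmn]
      push_cast; ring
  suffices H : f = g by
    have := congrArg (fun h : ArithmeticFunction ℂ ↦ h n) H
    simp only [hfn, hg, twistCount, hν] at this
    exact this
  refine (ArithmeticFunction.IsMultiplicative.eq_iff_eq_on_prime_powers f hfmul g hgmul).mpr fun p i hp ↦ ?_
  haveI : Fact p.Prime := ⟨hp⟩
  rcases i with _ | j
  · rw [pow_zero, hfmul.map_one, hgmul.map_one]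
  rw [hfn, hg]
  -- (a) the additive primes `3` and `p ∣ u`
  by_cases hbad : p = 3 ∨ (5 ≤ p ∧ (p : ℤ) ∣ k)
  · have hcase : p = 3 ∨ (5 ≤ p ∧ (p : ℤ) ∣ k) ∨ (p = 2 ∧ ¬ ∃ u : ℤ, u % 4 = 1 ∧ k = 16 * u) := by
      rcases hbad with h | h
      · exact Or.inl h
      · exact Or.inr (Or.inl h)
    have hpM : (p : 𝓞 K3) ∣ 3 * D := by
      rcases hbad with rfl | ⟨hp5, hpk⟩
      · exact dvd_mul_right _ _
      · have hpu : (p : ℤ) ∣ u := by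
          rw [hku] at hpk
          rcases (Nat.prime_iff_prime_int.mp hp).dvd_or_dvd hpk with h16 | h
          · exfalso
            have : p ∣ 2 ^ 4 := by exact_mod_cast h16
            have := (Nat.prime_dvd_prime_iff_eq hp Nat.prime_two).mp (hp.dvd_of_dvd_pow this)
            omega
          · exact h
        obtain ⟨t, rfl⟩ := hpu
        refine ⟨((3 * t : ℤ) : 𝓞 K3), ?_⟩
        rw [hD]; push_cast; ring
    rw [lFunction_apply_prime_pow_eq_zero hk h6 hp hcase j, twistCount_prime_pow_eq_zero_of_dvd ν hνsupp hp hpM (Nat.succ_ne_zero j)]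
    simp
  push Not at hbad
  obtain ⟨hp3', hp5⟩ := hbad
  -- (b) the good prime `2`
  by_cases hp2 : p = 2
  · subst hp2
    have hj2 : jacobiSym u 2 = 1 := by
      haveI : Fact (Nat.Prime 2) := ⟨Nat.prime_two⟩
      rw [← jacobiSym.legendreSym.to_jacobiSym, legendreSym.mod 2 u, show u % (2 : ℕ) = 1 by omega, legendreSym.at_one]
    obtain ⟨m, hm | hm⟩ := Nat.even_or_odd' (j + 1)
    · rw [hm, (lFunction_apply_two_pow_of_eq_sixteen_mul hu4 hku m).1, (twistCount_prime_pow_of_mod_three_eq_two ν Nat.prime_two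
        (by norm_num) m).1, hν, hD, weight_span_two hu2, jacobiSym.pow_right, hj2]
      push_cast; ring
    · rw [hm, (lFunction_apply_two_pow_of_eq_sixteen_mul hu4 hku m).2, (twistCount_prime_pow_of_mod_three_eq_two ν Nat.prime_two
        (by norm_num) m).2]
      simp
  have hp5' : 5 ≤ p := by
    by_contra hlt
    have h2le := hp.two_le
    interval_cases p
    · exact hp2 rfl
    · exact hp3' rfl
    · exact absurd hp (by decide)
  have hpk : ¬ (p : ℤ) ∣ k := hp5 hp5'
  have hpu : ¬ (p : ℤ) ∣ u := fun h ↦ hpk (hku ▸ h.mul_left 16)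
  have hp3u : ¬ (p : ℤ) ∣ 3 * u := by
    intro h
    rcases (Nat.prime_iff_prime_int.mp hp).dvd_or_dvd h with h3 | h'
    · have : p ∣ 3 := by exact_mod_cast h3
      exact hp3' ((Nat.prime_dvd_prime_iff_eq hp Nat.prime_three).mp this)
    · exact hpu h'
  rcases Nat.lt_or_ge (p % 3) 2 with hlt | hge
  swap
  · -- (c) inert primes `p ≡ 2 (3)`, `p` odd, `p ∤ u`
    have hp3 : p % 3 = 2 := by omega
    obtain ⟨m, hm | hm⟩ := Nat.even_or_odd' (j + 1)
    · rw [hm, (lFunction_apply_prime_pow_of_mod_three_eq_two hp hp3 hp2 hpk m).1,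
        (twistCount_prime_pow_of_mod_three_eq_two ν hp hp3 m).1, hν, hD, weight_span_natCast_of_mod_three_eq_two hp hp3 hp2 hp3u,
        jacobiSym.pow_right, ← jacobiSym.legendreSym.to_jacobiSym, pow_mul,
        legendreSym.sq_one p (by rwa [Ne, ZMod.intCast_zmod_eq_zero_iff_dvd])]
      push_cast; ring
    · rw [hm, (lFunction_apply_prime_pow_of_mod_three_eq_two hp hp3 hp2 hpk m).2,
        (twistCount_prime_pow_of_mod_three_eq_two ν hp hp3 m).2]
      simp
  · -- (d) split primes `p ≡ 1 (3)`
    have hp3 : p % 3 = 1 := by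
      have h0 : p % 3 ≠ 0 := fun h0 ↦ hp3' ((Nat.prime_dvd_prime_iff_eq Nat.prime_three hp).mp (Nat.dvd_of_mod_eq_zero h0)).symm
      omega
    obtain ⟨v, ϖ, hvw, hfib, hpv, hdeg, -, hϖ, hϖ1, hnorm, hval⟩ := exists_split_data hp hp3
    have hpv' : (p : 𝓞 K3) ∈ v.asIdeal := by have h := hpv; rwa [Int.cast_natCast] at h
    have h3v : (3 : 𝓞 K3) ∉ v.asIdeal := by
      have := intCast_not_mem hp hpv (n := 3) (by
        intro h; have : p ∣ 3 := by exact_mod_cast h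
        exact hp3' ((Nat.prime_dvd_prime_iff_eq hp Nat.prime_three).mp this))
      rwa [Int.cast_ofNat] at this
    rw [lFunction_apply_prime_pow_split (K := K3) EisensteinGrossen.hζ hp3 hpk embC.toRingHom hpv' hdeg hϖ hϖ1 (j + 1)]
    rw [twistCount_prime_pow_split ν hp hvw hfib hdeg (j + 1)]
    -- `(k/p) = (u/p)` and `χ_v(4k) = χ_v(64u) = χ_v(u)`
    have hleg : legendreSym p k = legendreSym p u := by
      rw [hku, show (16 * u : ℤ) = 4 ^ 2 * u by ring, legendreSym.mul, legendreSym.sq_one', one_mul]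
      intro h0
      have : ((4 : ℤ) : ZMod p) = 0 := by exact_mod_cast h0
      rw [ZMod.intCast_zmod_eq_zero_iff_dvd] at this
      have : p ∣ 2 ^ 2 := by exact_mod_cast this
      exact hp2 ((Nat.prime_dvd_prime_iff_eq hp Nat.prime_two).mp (hp.dvd_of_dvd_pow this))
    have hcube : cubicResidueSymbol v (Ideal.Quotient.mk v.asIdeal ((4 * k : ℤ) : 𝓞 K3)) =
        cubicResidueSymbol v (Ideal.Quotient.mk v.asIdeal D) := by
      letI := Ideal.Quotient.field v.asIdeal
      have h4 : Ideal.Quotient.mk v.asIdeal ((4 : ℤ) : 𝓞 K3) ≠ 0 := by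
        intro h0
        rw [Ideal.Quotient.eq_zero_iff_mem] at h0
        exact intCast_not_mem hp hpv (n := 4) (by
          intro h; have : p ∣ 2 ^ 2 := by exact_mod_cast h
          exact hp2 ((Nat.prime_dvd_prime_iff_eq hp Nat.prime_two).mp (hp.dvd_of_dvd_pow this))) h0
      have hc3 := (cubicResidueSymbol_spec EisensteinGrossen.hζ h3v h4).1
      have hpow : ∀ y : 𝓞 K3 ⧸ v.asIdeal, cubicResidueSymbol v (y ^ 3) = cubicResidueSymbol v y ^ 3 := fun y ↦ by
        rw [← cubicResidueChar_apply EisensteinGrossen.hζ h3v, ← cubicResidueChar_apply EisensteinGrossen.hζ h3v y, map_pow]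
      rw [hD, hku, show ((4 * (16 * u) : ℤ) : 𝓞 K3) = ((4 : ℤ) : 𝓞 K3) ^ 3 * ((u : ℤ) : 𝓞 K3) by push_cast; ring,
        map_mul (Ideal.Quotient.mk v.asIdeal), map_pow, cubicResidueSymbol_mul EisensteinGrossen.hζ, hpow, hc3, one_mul]
    have hνv : ν v.asIdeal = embC ((cubicResidueSymbol v (Ideal.Quotient.mk v.asIdeal D) : 𝓞 K3) : K3) * embC (ϖ : K3) := by
      have hcop : IsCoprime v.asIdeal three := by rw [← hϖ]; exact isCoprime_three_of_sub_one_mem hϖ1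
      rw [hν, hD, hval u 1 0 hp3u, pow_one, sectorWeight, pow_zero, mul_one, primGen_eq_of hcop hϖ hϖ1]
    have hνw : ν (conjPrime v).asIdeal = conj (ν v.asIdeal) := by
      rw [hν, hν, hD, grossenNu_conjPrime, conjPrime_asIdeal,
        primGen_map_tau (by rw [← hϖ]; exact isCoprime_three_of_sub_one_mem hϖ1), embC_tau, map_mul]
    have hreal : conj ((legendreSym p u : ℤ) : ℂ) = ((legendreSym p u : ℤ) : ℂ) := map_intCast _ _
    rw [Finset.mul_sum]
    refine Finset.sum_congr rfl fun a ha ↦ ?_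
    rw [Finset.mem_range] at ha
    rw [hνw, hνv, ← hcube, hleg, jacobiSym.pow_right, ← jacobiSym.legendreSym.to_jacobiSym, map_mul, map_mul, map_mul, hreal]
    simp only [RingHom.coe_coe, AlgHom.toRingHom_eq_coe]
    have hl : ((legendreSym p u : ℤ) : ℂ) ^ (j + 1) = ((legendreSym p u : ℤ) : ℂ) ^ a * ((legendreSym p u : ℤ) : ℂ) ^ (j + 1 - a) := by
      rw [← pow_add]; congr 1; omega
    rw [Int.cast_pow, hl]
    ring

end SexticTwist

end Literature.NumberTheory.EllipticCurves

end
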